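import Literature.Algebra.Homology.MapBifunctorSingleColumn
import Literature.AlgebraicGeometry.HodgeTheory.HomComplexQuasiIso
import Mathlib.Algebra.Homology.BifunctorFlip
import HarnessLib

/-!
# `F(E•, –)` preserves the quasi-isomorphisms that every `F(Eᵖ, –)` preserves, for `E•` bounded
# (total complex of a bifunctor: degreewise-split short exact sequences and induction on the amplitude)

Layer `Literature/Algebra/Homology` (pure homological algebra over Mathlib; 0 named facts, no instances). For a bifunctor
`F : C₁ ⥤ C₂ ⥤ D` additive in each variable (`C₁` abelian, `D` abelian), a BOUNDED cochain complex `E• ∈ [a, b]` in `C₁` and a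
morphism `φ : K• ⟶ K'•` of cochain complexes in `C₂`:

* `boxShortComplex F S K` — a short complex `S = (A• → E• → Q•)` of complexes in the first variable gives the short complex of total
  complexes `F(A•, K•) → F(E•, K•) → F(Q•, K•)` (Mathlib `mapBifunctorMap`), DEGREEWISE SPLIT when `S` is (`boxShortComplexSplitting`,
  summand by summand), hence short exact (`boxShortComplex_shortExact`); `quasiIso_mapBifunctorMap_id_of_degreewiseSplit` — the
  induction step, by two-out-of-three for quasi-isomorphisms on the middle term (the tree's `HodgeTheory.quasiIso_τ₂`);
* **`quasiIso_mapBifunctorMap_id`** — if `F(Eᵖ, –)•φ` is a quasi-isomorphism for every `p`, then so is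
  `F(E•, –)•φ := mapBifunctorMap (𝟙 E•) φ` — induction on `b - a` by the top-degree truncation `Eᵇ[b] ↪ E• ↠ E•/Eᵇ[b]` (the tree's
  `HodgeTheory.TopTrunc`, degreewise split) and the one-term case `Literature/Algebra/Homology/MapBifunctorSingleColumn`;
* **`quasiIso_mapBifunctorMap_id_right`** — the same with the bounded complex in the SECOND variable and the morphism in the first
  (Mathlib `mapBifunctorFlipIso`, natural in both variables).

This is the standard «a map of double complexes with uniformly bounded rows which is a quasi-isomorphism on each row induces a
quasi-isomorphism of total complexes» in the generality needed for the Tor-independent box of two strictly perfect resolutions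
(`AlgebraicGeometry/Modules/BoxTensorResolution`): no spectral sequence, only the long exact homology sequence. Template: the tree's
`HodgeTheory/HomComplexExact` §3–4 and `HomComplexQuasiIso` §3 (the internal-Hom complex), transposed to a covariant bifunctor.

## References

* C. A. Weibel, *An introduction to homological algebra* (1994), 1.2.6–1.2.8 (total complex, truncations), Thm. 1.3.1 and Ex. 1.3.3
  (long exact sequence, 5-lemma), 2.7.1–2.7.3 and 5.6 (double complexes with exact rows). [Weibel1994]
* The Stacks Project, Tag 012Z (total complex), Tag 0133 (acyclic double complexes). [StacksProject]
-/

noncomputable section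

-- `GradedObject`/`HomologicalComplex₂.toGradedObject` are not reducible (as in Mathlib's `Algebra/Homology/TotalComplex.lean`).
set_option backward.isDefEq.respectTransparency false

open CategoryTheory CategoryTheory.Category CategoryTheory.Limits HomologicalComplex

universe v₁ v₂ v₃ u₁ u₂ u₃

namespace Literature.Algebra.Homology

/-! ### §1 Degreewise-split short exact sequences in the first variable -/

section Split

variable {C₁ : Type u₁} [Category.{v₁} C₁] [Preadditive C₁]
  {C₂ : Type u₂} [Category.{v₂} C₂] [Preadditive C₂]
  {D : Type u₃} [Category.{v₃} D] [Abelian D]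
  (F : C₁ ⥤ C₂ ⥤ D) [F.Additive] [∀ X₁, (F.obj X₁).Additive]
  [∀ (K₁ : CochainComplex C₁ ℤ) (K₂ : CochainComplex C₂ ℤ), HasMapBifunctor K₁ K₂ F (ComplexShape.up ℤ)]

/-- `mapBifunctorMap 0 (𝟙 K) = 0`: `E• ↦ F(E•, K•)` preserves zero morphisms (theorem, bind with `haveI`). [cite: Weibel1994, 2.6] -/
theorem preservesZeroMorphisms_map₂_flip_obj (K : CochainComplex C₂ ℤ) :
    (F.map₂CochainComplex.flip.obj K).PreservesZeroMorphisms := by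
  refine ⟨fun E E' => HomologicalComplex.hom_ext _ _ fun n => mapBifunctor.hom_ext fun i j (hij : i + j = n) => ?_⟩
  change ιMapBifunctor E K F (ComplexShape.up ℤ) i j n hij ≫ (mapBifunctorMap (0 : E ⟶ E') (𝟙 K) F (ComplexShape.up ℤ)).f n = _
  rw [ι_mapBifunctorMap, zero_f, zero_f, F.map_zero, zero_app, zero_comp, comp_zero]

variable (S : ShortComplex (CochainComplex C₁ ℤ)) (K : CochainComplex C₂ ℤ)

/-- The short complex of total complexes `F(S.X₁, K•) → F(S.X₂, K•) → F(S.X₃, K•)` of a short complex `S` of cochain complexes in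
the first variable. [folklore] -/
def boxShortComplex : ShortComplex (CochainComplex D ℤ) :=
  haveI := preservesZeroMorphisms_map₂_flip_obj F K
  S.map (F.map₂CochainComplex.flip.obj K)

/-- Its first map is `mapBifunctorMap S.f (𝟙 K)`. [cite: Weibel1994, 1.2.6] -/
theorem boxShortComplex_f : (boxShortComplex F S K).f = mapBifunctorMap S.f (𝟙 K) F (ComplexShape.up ℤ) := rfl

/-- Its second map is `mapBifunctorMap S.g (𝟙 K)`. [cite: Weibel1994, 1.2.6] -/
theorem boxShortComplex_g : (boxShortComplex F S K).g = mapBifunctorMap S.g (𝟙 K) F (ComplexShape.up ℤ) := rfl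

variable (σ : ∀ m : ℤ, (S.map (HomologicalComplex.eval C₁ (ComplexShape.up ℤ) m)).Splitting)

/-- The degreewise retraction `S.X₂ⁱ ⟶ S.X₁ⁱ` of a degreewise splitting (retyped). [folklore] -/
def ret (i : ℤ) : S.X₂.X i ⟶ S.X₁.X i := (σ i).r

/-- The degreewise section `S.X₃ⁱ ⟶ S.X₂ⁱ` of a degreewise splitting (retyped). [folklore] -/
def sec (i : ℤ) : S.X₃.X i ⟶ S.X₂.X i := (σ i).s

/-- `f ≫ r = 𝟙` degreewise. [cite: Weibel1994, 1.2.6] -/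
theorem f_ret (i : ℤ) : S.f.f i ≫ ret S σ i = 𝟙 _ := (σ i).f_r

/-- `s ≫ g = 𝟙` degreewise. [cite: Weibel1994, 1.2.6] -/
theorem sec_g (i : ℤ) : sec S σ i ≫ S.g.f i = 𝟙 _ := (σ i).s_g

/-- `r ≫ f + g ≫ s = 𝟙` degreewise. [cite: Weibel1994, 1.2.6] -/
theorem ret_f_add_g_sec (i : ℤ) : ret S σ i ≫ S.f.f i + S.g.f i ≫ sec S σ i = 𝟙 _ := (σ i).id

/-- Degree-`m` retraction `F(S.X₂, K•)ᵐ ⟶ F(S.X₁, K•)ᵐ`: `F(r, Kʲ)` summand by summand, `r` the degreewise retractions of `S`. [folklore] -/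
def rBox (m : ℤ) : (mapBifunctor S.X₂ K F (ComplexShape.up ℤ)).X m ⟶ (mapBifunctor S.X₁ K F (ComplexShape.up ℤ)).X m :=
  mapBifunctorDesc fun i j (hij : i + j = m) => (F.map (ret S σ i)).app (K.X j) ≫ ιMapBifunctor S.X₁ K F (ComplexShape.up ℤ) i j m hij

/-- Degree-`m` section `F(S.X₃, K•)ᵐ ⟶ F(S.X₂, K•)ᵐ`: `F(s, Kʲ)` summand by summand, `s` the degreewise sections of `S`. [folklore] -/
def sBox (m : ℤ) : (mapBifunctor S.X₃ K F (ComplexShape.up ℤ)).X m ⟶ (mapBifunctor S.X₂ K F (ComplexShape.up ℤ)).X m :=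
  mapBifunctorDesc fun i j (hij : i + j = m) => (F.map (sec S σ i)).app (K.X j) ≫ ιMapBifunctor S.X₂ K F (ComplexShape.up ℤ) i j m hij

/-- `F(f, K) ≫ rBox = 𝟙` in each degree. [cite: Weibel1994, 1.2.6 and 2.6] -/
theorem map_f_rBox (m : ℤ) : (mapBifunctorMap S.f (𝟙 K) F (ComplexShape.up ℤ)).f m ≫ rBox F S K σ m = 𝟙 _ := by
  refine mapBifunctor.hom_ext fun i j (hij : i + j = m) => ?_
  rw [ι_mapBifunctorMap_assoc, id_f, CategoryTheory.Functor.map_id, id_comp, rBox, ι_mapBifunctorDesc, ← Category.assoc,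
    ← NatTrans.comp_app, ← F.map_comp, f_ret, F.map_id, NatTrans.id_app, id_comp, comp_id]

/-- `sBox ≫ F(g, K) = 𝟙` in each degree. [cite: Weibel1994, 1.2.6 and 2.6] -/
theorem sBox_map_g (m : ℤ) : sBox F S K σ m ≫ (mapBifunctorMap S.g (𝟙 K) F (ComplexShape.up ℤ)).f m = 𝟙 _ := by
  refine mapBifunctor.hom_ext fun i j (hij : i + j = m) => ?_
  rw [sBox, ι_mapBifunctorDesc_assoc, Category.assoc, ι_mapBifunctorMap, id_f, CategoryTheory.Functor.map_id, id_comp,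
    ← Category.assoc, ← NatTrans.comp_app, ← F.map_comp, sec_g, F.map_id, NatTrans.id_app, id_comp, comp_id]

/-- `rBox ≫ F(f, K) + F(g, K) ≫ sBox = 𝟙` in each degree. [cite: Weibel1994, 1.2.6 and 2.6] -/
theorem rBox_f_add_g_sBox (m : ℤ) :
    rBox F S K σ m ≫ (mapBifunctorMap S.f (𝟙 K) F (ComplexShape.up ℤ)).f m +
      (mapBifunctorMap S.g (𝟙 K) F (ComplexShape.up ℤ)).f m ≫ sBox F S K σ m = 𝟙 _ := by
  refine mapBifunctor.hom_ext fun i j (hij : i + j = m) => ?_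
  rw [Preadditive.comp_add, rBox, ι_mapBifunctorDesc_assoc, Category.assoc, ι_mapBifunctorMap, id_f,
    CategoryTheory.Functor.map_id, id_comp, ← Category.assoc, ← NatTrans.comp_app, ← F.map_comp, ι_mapBifunctorMap_assoc, id_f,
    CategoryTheory.Functor.map_id, id_comp, sBox, ι_mapBifunctorDesc, ← Category.assoc, ← NatTrans.comp_app, ← F.map_comp,
    ← Preadditive.add_comp, ← NatTrans.app_add, ← F.map_add, ret_f_add_g_sec, F.map_id, NatTrans.id_app, id_comp, comp_id]

/-- **Degreewise splitting** of `F(S.X₁, K•) → F(S.X₂, K•) → F(S.X₃, K•)` from a degreewise splitting of `S`. [folklore] -/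
def boxShortComplexSplitting (m : ℤ) :
    ((boxShortComplex F S K).map (HomologicalComplex.eval D (ComplexShape.up ℤ) m)).Splitting where
  r := rBox F S K σ m
  s := sBox F S K σ m
  f_r := map_f_rBox F S K σ m
  s_g := sBox_map_g F S K σ m
  id := rBox_f_add_g_sBox F S K σ m

/-- **Short exactness**: for `S` degreewise split, `0 → F(S.X₁, K•) → F(S.X₂, K•) → F(S.X₃, K•) → 0` is short exact.
[cite: Weibel1994, 1.2.6 and 2.6] -/
theorem boxShortComplex_shortExact (σ : ∀ m : ℤ, (S.map (HomologicalComplex.eval C₁ (ComplexShape.up ℤ) m)).Splitting) :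
    (boxShortComplex F S K).ShortExact :=
  shortExact_of_degreewise_shortExact _ fun m => (boxShortComplexSplitting F S K σ m).shortExact

variable {K} in
/-- The morphism of short complexes `F(S, K•) ⟶ F(S, K'•)` induced by `φ : K• ⟶ K'•` (its middle component is
`mapBifunctorMap (𝟙 S.X₂) φ`). [folklore] -/
def boxShortComplexMap {K' : CochainComplex C₂ ℤ} (φ : K ⟶ K') : boxShortComplex F S K ⟶ boxShortComplex F S K' :=
  haveI := preservesZeroMorphisms_map₂_flip_obj F K
  haveI := preservesZeroMorphisms_map₂_flip_obj F K'
  S.mapNatTrans (F.map₂CochainComplex.flip.map φ)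

/-- **Induction step.** For `S = (A• → E• → Q•)` degreewise split: if `F(A•, –)•φ` and `F(Q•, –)•φ` are quasi-isomorphisms, so is
`F(E•, –)•φ` (two-out-of-three for quasi-isomorphisms, middle term). [cite: Weibel1994, Thm. 1.3.1 and Ex. 1.3.3] -/
theorem quasiIso_mapBifunctorMap_id_of_degreewiseSplit
    (σ : ∀ m : ℤ, (S.map (HomologicalComplex.eval C₁ (ComplexShape.up ℤ) m)).Splitting) {K K' : CochainComplex C₂ ℤ} (φ : K ⟶ K')
    (h₁ : QuasiIso (mapBifunctorMap (𝟙 S.X₁) φ F (ComplexShape.up ℤ)))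
    (h₃ : QuasiIso (mapBifunctorMap (𝟙 S.X₃) φ F (ComplexShape.up ℤ))) :
    QuasiIso (mapBifunctorMap (𝟙 S.X₂) φ F (ComplexShape.up ℤ)) :=
  Literature.AlgebraicGeometry.HodgeTheory.quasiIso_τ₂ (boxShortComplexMap F S φ)
    (boxShortComplex_shortExact F S K σ) (boxShortComplex_shortExact F S K' σ) h₁ h₃

end Split

/-! ### §2 Vanishing and transport lemmas -/

section Transport

variable {C₁ : Type u₁} [Category.{v₁} C₁] [Preadditive C₁]
  {C₂ : Type u₂} [Category.{v₂} C₂] [Preadditive C₂]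
  {D : Type u₃} [Category.{v₃} D] [Abelian D]
  (F : C₁ ⥤ C₂ ⥤ D) [F.Additive] [∀ X₁, (F.obj X₁).Additive]
  [∀ (K₁ : CochainComplex C₁ ℤ) (K₂ : CochainComplex C₂ ℤ), HasMapBifunctor K₁ K₂ F (ComplexShape.up ℤ)]
  {K K' : CochainComplex C₂ ℤ} (φ : K ⟶ K')

omit [F.Additive] [∀ X₁, (F.obj X₁).Additive]
  [∀ (K₁ : CochainComplex C₁ ℤ) (K₂ : CochainComplex C₂ ℤ), HasMapBifunctor K₁ K₂ F (ComplexShape.up ℤ)] in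
/-- A morphism between degreewise-zero complexes is a quasi-isomorphism. [cite: Weibel1994, 1.1 (exact complexes)] -/
theorem quasiIso_of_isZero_X {L L' : CochainComplex D ℤ} (f : L ⟶ L') (hL : ∀ n, IsZero (L.X n)) (hL' : ∀ n, IsZero (L'.X n)) :
    QuasiIso f := by
  rw [quasiIso_iff]
  intro n
  rw [quasiIsoAt_iff_isIso_homologyMap]
  exact ⟨⟨0, (ExactAt.of_isZero (hL n)).isZero_homology.eq_of_src _ _, (ExactAt.of_isZero (hL' n)).isZero_homology.eq_of_src _ _⟩⟩

/-- `F(E•, K•)ⁿ = 0` when every summand `F(Eⁱ, Kʲ)`, `i + j = n`, is zero. [cite: Weibel1994, 1.2.6] -/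
theorem isZero_mapBifunctor_X (E : CochainComplex C₁ ℤ) (L : CochainComplex C₂ ℤ) (n : ℤ)
    (h : ∀ i j : ℤ, i + j = n → IsZero ((F.obj (E.X i)).obj (L.X j))) :
    IsZero ((mapBifunctor E L F (ComplexShape.up ℤ)).X n) := by
  rw [IsZero.iff_id_eq_zero]
  exact mapBifunctor.hom_ext fun i j (hij : i + j = n) => (h i j hij).eq_of_src _ _

/-- `F(E•, –)•φ` is a quasi-isomorphism when `E•` is degreewise zero (both total complexes vanish). [cite: Weibel1994, 1.2.6] -/
theorem quasiIso_mapBifunctorMap_id_of_isZero (E : CochainComplex C₁ ℤ) (hE : ∀ p, IsZero (E.X p)) :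
    QuasiIso (mapBifunctorMap (𝟙 E) φ F (ComplexShape.up ℤ)) :=
  quasiIso_of_isZero_X _ (fun n => isZero_mapBifunctor_X F E K n fun i _ _ => isZero_obj_obj_of_isZero_left F (hE i) _)
    (fun n => isZero_mapBifunctor_X F E K' n fun i _ _ => isZero_obj_obj_of_isZero_left F (hE i) _)

omit [∀ (K₁ : CochainComplex C₁ ℤ) (K₂ : CochainComplex C₂ ℤ), HasMapBifunctor K₁ K₂ F (ComplexShape.up ℤ)] in
/-- `F(X, –)•φ` is a quasi-isomorphism for `X` a zero object. [cite: Weibel1994, 2.6] -/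
theorem quasiIso_map_mapHomologicalComplex_of_isZero {X : C₁} (hX : IsZero X) :
    QuasiIso (((F.obj X).mapHomologicalComplex (ComplexShape.up ℤ)).map φ) :=
  quasiIso_of_isZero_X _ (fun _ => isZero_obj_obj_of_isZero_left F hX _) (fun _ => isZero_obj_obj_of_isZero_left F hX _)

omit [Preadditive C₁] [F.Additive] [∀ (K₁ : CochainComplex C₁ ℤ) (K₂ : CochainComplex C₂ ℤ), HasMapBifunctor K₁ K₂ F (ComplexShape.up ℤ)] in
/-- `QuasiIso (F(X, –)•φ)` is transported along isomorphisms `X ≅ X'`. [cite: Weibel1994, 2.6] -/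
theorem quasiIso_map_mapHomologicalComplex_of_iso {X X' : C₁} (e : X ≅ X')
    (h : QuasiIso (((F.obj X).mapHomologicalComplex (ComplexShape.up ℤ)).map φ)) :
    QuasiIso (((F.obj X').mapHomologicalComplex (ComplexShape.up ℤ)).map φ) :=
  quasiIso_of_arrow_mk_iso (((F.obj X).mapHomologicalComplex (ComplexShape.up ℤ)).map φ) _
    (Arrow.isoMk ((NatIso.mapHomologicalComplex (F.mapIso e) (ComplexShape.up ℤ)).app K)
      ((NatIso.mapHomologicalComplex (F.mapIso e) (ComplexShape.up ℤ)).app K')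
      (by exact ((NatIso.mapHomologicalComplex (F.mapIso e) (ComplexShape.up ℤ)).hom.naturality φ).symm))

end Transport

/-! ### §3 The theorem: bounded complex in the first variable -/

section Bounded

variable {C₁ : Type u₁} [Category.{v₁} C₁] [Abelian C₁]
  {C₂ : Type u₂} [Category.{v₂} C₂] [Preadditive C₂]
  {D : Type u₃} [Category.{v₃} D] [Abelian D]
  (F : C₁ ⥤ C₂ ⥤ D) [F.Additive] [∀ X₁, (F.obj X₁).Additive]
  [∀ (K₁ : CochainComplex C₁ ℤ) (K₂ : CochainComplex C₂ ℤ), HasMapBifunctor K₁ K₂ F (ComplexShape.up ℤ)]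
  {K K' : CochainComplex C₂ ℤ} (φ : K ⟶ K')

open Literature.AlgebraicGeometry.HodgeTheory in
/-- Induction on the amplitude. [cite: Weibel1994, 1.2.7–1.2.8 and Thm. 1.3.1] -/
theorem quasiIso_mapBifunctorMap_id_aux (m : ℕ) :
    ∀ (E : CochainComplex C₁ ℤ) (a b : ℤ), b - a < m → E.IsStrictlyGE a → E.IsStrictlyLE b →
      (∀ p, QuasiIso (((F.obj (E.X p)).mapHomologicalComplex (ComplexShape.up ℤ)).map φ)) →
        QuasiIso (mapBifunctorMap (𝟙 E) φ F (ComplexShape.up ℤ)) := by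
  induction m with
  | zero =>
    intro E a b hab _ _ _
    exact quasiIso_mapBifunctorMap_id_of_isZero F φ E fun p => by
      by_cases hp : p < a
      · exact E.isZero_of_isStrictlyGE a p hp
      · exact E.isZero_of_isStrictlyLE b p (by lia)
  | succ m ih =>
    intro E a b hab _ _ hE
    have h₃ : QuasiIso (mapBifunctorMap (𝟙 (TopTrunc.truncSES E b).X₃) φ F (ComplexShape.up ℤ)) :=
      ih _ a (b - 1) (by lia) inferInstance inferInstance fun p => by
        by_cases hp : p = b
        · subst hp
          exact quasiIso_map_mapHomologicalComplex_of_isZero F φ (TopTrunc.isZero_trunc_X_self E p)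
        · exact quasiIso_map_mapHomologicalComplex_of_iso F φ
            (@asIso _ _ _ _ ((cokernel.π (TopTrunc.topι E b)).f p) (TopTrunc.isIso_truncπ_f E b p hp)) (hE p)
    have h₁ : QuasiIso (mapBifunctorMap (𝟙 (TopTrunc.truncSES E b).X₁) φ F (ComplexShape.up ℤ)) :=
      quasiIso_mapBifunctorMap_single F φ (E.X b) b (hE b)
    exact quasiIso_mapBifunctorMap_id_of_degreewiseSplit F (TopTrunc.truncSES E b) (TopTrunc.truncSESSplitting E b) φ h₁ h₃

/-- **`F(E•, –)` preserves the quasi-isomorphisms preserved by every `F(Eᵖ, –)`, for `E•` bounded**: if `E• ∈ [a, b]` strictly and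
`F(Eᵖ, –)•φ` is a quasi-isomorphism for every `p` (e.g. `F(Eᵖ, –)` exact and `φ` a quasi-isomorphism), then
`F(E•, –)•φ = mapBifunctorMap (𝟙 E•) φ` is a quasi-isomorphism. Proof: induction on `b - a` by the degreewise-split top truncation
`Eᵇ[b] ↪ E• ↠ E•/Eᵇ[b]`, §1 and the one-term case. [cite: Weibel1994, 2.7.1–2.7.3, 5.6 and Thm. 1.3.1] [cite: StacksProject, Tag 0133] -/
theorem quasiIso_mapBifunctorMap_id (E : CochainComplex C₁ ℤ) (a b : ℤ) [E.IsStrictlyGE a] [E.IsStrictlyLE b]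
    (hE : ∀ p, QuasiIso (((F.obj (E.X p)).mapHomologicalComplex (ComplexShape.up ℤ)).map φ)) :
    QuasiIso (mapBifunctorMap (𝟙 E) φ F (ComplexShape.up ℤ)) :=
  quasiIso_mapBifunctorMap_id_aux F φ (b - a).toNat.succ E a b (by lia) inferInstance inferInstance hE

end Bounded

/-! ### §4 The theorem: bounded complex in the second variable -/

section BoundedRight

variable {C₁ : Type u₁} [Category.{v₁} C₁] [Preadditive C₁]
  {C₂ : Type u₂} [Category.{v₂} C₂] [Abelian C₂]
  {D : Type u₃} [Category.{v₃} D] [Abelian D]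
  (F : C₁ ⥤ C₂ ⥤ D) [F.Additive] [∀ X₁, (F.obj X₁).Additive] [F.flip.Additive] [∀ X₂, (F.flip.obj X₂).Additive]
  [∀ (K₁ : CochainComplex C₁ ℤ) (K₂ : CochainComplex C₂ ℤ), HasMapBifunctor K₁ K₂ F (ComplexShape.up ℤ)]
  {K K' : CochainComplex C₁ ℤ} (ψ : K ⟶ K')

/-- **The same with the bounded complex in the second variable**: if `E• ∈ [a, b]` strictly (in `C₂`) and `F(–, Eᵖ)•ψ` is a
quasi-isomorphism for every `p`, then `F(–, E•)•ψ = mapBifunctorMap ψ (𝟙 E•)` is a quasi-isomorphism (§3 for `F.flip` and Mathlib's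
`mapBifunctorFlipIso`, natural in both variables). [cite: Weibel1994, 2.7.1–2.7.3 and 5.6] [cite: StacksProject, Tag 0133] -/
theorem quasiIso_mapBifunctorMap_id_right (E : CochainComplex C₂ ℤ) (a b : ℤ) [E.IsStrictlyGE a] [E.IsStrictlyLE b]
    (hE : ∀ p, QuasiIso (((F.flip.obj (E.X p)).mapHomologicalComplex (ComplexShape.up ℤ)).map ψ)) :
    QuasiIso (mapBifunctorMap ψ (𝟙 E) F (ComplexShape.up ℤ)) := by
  haveI : ∀ (K₂ : CochainComplex C₂ ℤ) (K₁ : CochainComplex C₁ ℤ), HasMapBifunctor K₂ K₁ F.flip (ComplexShape.up ℤ) :=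
    fun K₂ K₁ => inferInstance
  haveI := quasiIso_mapBifunctorMap_id F.flip ψ E a b hE
  exact quasiIso_of_arrow_mk_iso (mapBifunctorMap (𝟙 E) ψ F.flip (ComplexShape.up ℤ)) _
    (Arrow.isoMk (mapBifunctorFlipIso K E F (ComplexShape.up ℤ)) (mapBifunctorFlipIso K' E F (ComplexShape.up ℤ))
      (by exact (mapBifunctorFlipIso_hom_naturality ψ (𝟙 E) F (ComplexShape.up ℤ)).symm))

end BoundedRight

end Literature.Algebra.Homology

end
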